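import Literature.GroupTheory.ArithmeticGroups.SL2Mod8Relations
import Literature.NumberTheory.Automorphic.UnboundedDenominatorsInvariantHom
import Literature.NumberTheory.EllipticCurves.ModularCurveGamma0IndexProofs
import HarnessLib

/-!
# The base of the `2`-adic descent: central extensions of `SL₂(ℤ/8)`, III (the theorem `P(3)`)

**Theorem (`eq_one_of_tau_eq_one`).**  Let `π : E ↠ SL₂(ℤ/8)` be a central extension whose kernel has exponent
`2`, and `t ∈ E` a lift of `T̄ = (1 1; 0 1)` with `t⁸ = 1`.  Then `ker π ∩ [E, E] = 1`.

With the relations of `SL2Mod8Relations` (`u = l²`, `d = [t,u]`, `y = [u,d]`): `D̂ = {dⁱ yʲ}` is a subgroup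
normalised by `t^{±1}, u^{±1}` and by the kernel, meeting `ker π` trivially; the subgroup `H₀` generated by `t`,
`u` and `ker π` contains the preimage `H` of the Sylow `2`-subgroup `⟨T̄, U⟩` (index `3`; decomposition through
the layers modulo `2`, `4`, `8`), and `[H₀, H₀] ⊆ D̂`; the transfer `E → H` sends a central `z ∈ [E, E]` to
`z³ ∈ [H, H] ⊆ D̂ ∩ ker π = 1`, so `z = z³ = 1`.  This is `P(3)`, the base of the generic `2`-adic descent
`SL2TwoPowSchurMultiplier`; it replaces the machine computation at levels `8, 16` of
[CalegariDimitrovTang2025, §4.5, Lemma 4.5.10]; cf. [Beyl1986].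
-/

open scoped MatrixGroups commutatorElement

universe u

namespace Literature.GroupTheory.ArithmeticGroups

namespace SL2Mod8

open Matrix.SpecialLinearGroup

/-! ### Reductions modulo `4` and `2` -/

/-- The two-step reduction `ℤ/8 → ℤ/4 → ℤ/2` agrees with `ℤ/8 → ℤ/2` on `SL₂`. [cite: CalegariDimitrovTang2025,
§4.5, Lemma 4.5.10] -/
theorem map_castHom_four_two (M : SL(2, ZMod (2 ^ 3))) :
    Matrix.SpecialLinearGroup.map (ZMod.castHom (pow_dvd_pow 2 (Nat.sub_le 2 1)) (ZMod (2 ^ (2 - 1))))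
      (Matrix.SpecialLinearGroup.map (ZMod.castHom (pow_dvd_pow 2 (Nat.sub_le 3 1)) (ZMod (2 ^ (3 - 1)))) M) =
    Matrix.SpecialLinearGroup.map (ZMod.castHom (show 2 ∣ 2 ^ 3 by norm_num) (ZMod 2)) M := by
  have hcomp : (ZMod.castHom (pow_dvd_pow 2 (Nat.sub_le 2 1)) (ZMod (2 ^ (2 - 1)))).comp
      (ZMod.castHom (pow_dvd_pow 2 (Nat.sub_le 3 1)) (ZMod (2 ^ (3 - 1)))) =
      ZMod.castHom (show 2 ∣ 2 ^ 3 by norm_num) (ZMod 2) := Subsingleton.elim _ _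
  ext i j
  have h := RingHom.congr_fun hcomp (M i j)
  rw [RingHom.comp_apply] at h
  simp only [Matrix.SpecialLinearGroup.map_apply_coe, RingHom.mapMatrix_apply, Matrix.map_apply]
  exact h

variable (T L : SL(2, ZMod (2 ^ 3)))
  (hT : (T : Matrix (Fin 2) (Fin 2) (ZMod (2 ^ 3))) = !![1, 1; 0, 1])
  (hL : (L : Matrix (Fin 2) (Fin 2) (ZMod (2 ^ 3))) = !![1, 0; 1, 1])

include hT in
/-- `T̄² ↦ (1 2; 0 1)` modulo `4`. [cite: CalegariDimitrovTang2025, §4.5, Lemma 4.5.10] -/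
theorem coe_red4_T_sq : ((Matrix.SpecialLinearGroup.map (ZMod.castHom (pow_dvd_pow 2 (Nat.sub_le 3 1))
    (ZMod (2 ^ (3 - 1)))) (T ^ 2) : SL(2, ZMod (2 ^ 2))) : Matrix (Fin 2) (Fin 2) (ZMod (2 ^ 2))) =
    !![1, ((2 : ℕ) : ZMod (2 ^ 2)) ^ (2 - 1); 0, 1] := by
  rw [Matrix.SpecialLinearGroup.map_apply_coe, RingHom.mapMatrix_apply, coe_T_sq T hT]
  ext i j; fin_cases i <;> fin_cases j <;> simp [Matrix.map_apply, -ZMod.castHom_apply, map_ofNat]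

include hL in
/-- `L̄² ↦ (1 0; 2 1)` modulo `4`. [cite: CalegariDimitrovTang2025, §4.5, Lemma 4.5.10] -/
theorem coe_red4_L_sq : ((Matrix.SpecialLinearGroup.map (ZMod.castHom (pow_dvd_pow 2 (Nat.sub_le 3 1))
    (ZMod (2 ^ (3 - 1)))) (L ^ 2) : SL(2, ZMod (2 ^ 2))) : Matrix (Fin 2) (Fin 2) (ZMod (2 ^ 2))) =
    !![1, 0; ((2 : ℕ) : ZMod (2 ^ 2)) ^ (2 - 1), 1] := by
  rw [Matrix.SpecialLinearGroup.map_apply_coe, RingHom.mapMatrix_apply, coe_L_sq L hL]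
  ext i j; fin_cases i <;> fin_cases j <;> simp [Matrix.map_apply, -ZMod.castHom_apply, map_ofNat]

include hT hL in
/-- `T̄² [T̄, L̄²] ↦ 3·1 = (1+2 0; 0 1-2)` modulo `4`. [cite: CalegariDimitrovTang2025, §4.5, Lemma 4.5.10] -/
theorem coe_red4_T_sq_D : ((Matrix.SpecialLinearGroup.map (ZMod.castHom (pow_dvd_pow 2 (Nat.sub_le 3 1))
    (ZMod (2 ^ (3 - 1)))) (T ^ 2 * ⁅T, L ^ 2⁆) : SL(2, ZMod (2 ^ 2))) : Matrix (Fin 2) (Fin 2) (ZMod (2 ^ 2))) =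
    !![1 + ((2 : ℕ) : ZMod (2 ^ 2)) ^ (2 - 1), 0; 0, 1 - ((2 : ℕ) : ZMod (2 ^ 2)) ^ (2 - 1)] := by
  have h : ((T ^ 2 * ⁅T, L ^ 2⁆ : SL(2, ZMod (2 ^ 3))) : Matrix (Fin 2) (Fin 2) (ZMod (2 ^ 3))) = !![7, 4; 4, 7] := by
    rw [coe_mul, coe_T_sq T hT, coe_D T L hT hL]
    ext i j; fin_cases i <;> fin_cases j <;> simp [Matrix.mul_apply, Fin.sum_univ_two] <;> decide
  rw [Matrix.SpecialLinearGroup.map_apply_coe, RingHom.mapMatrix_apply, h]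
  ext i j; fin_cases i <;> fin_cases j <;> simp [Matrix.map_apply, -ZMod.castHom_apply, map_ofNat] <;> decide

/-! ### The theorem -/

/-- **`P(3)`: a central extension of `SL₂(ℤ/8)` with kernel of exponent `2` and a lift `t` of `T̄` with `t⁸ = 1`
has `ker ∩ [E, E] = 1`.** [cite: Beyl1986, Theorem (Schur multiplier of SL(2,ℤ/m)), 2-primary part] -/
theorem eq_one_of_tau_eq_one {E : Type u} [Group E] (π : E →* SL(2, ZMod (2 ^ 3)))
    (hsurj : Function.Surjective π) (hcen : ∀ z : E, π z = 1 → ∀ g : E, g * z = z * g)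
    (hK2 : ∀ z : E, π z = 1 → z ^ 2 = 1) (t : E)
    (ht : ((π t : SL(2, ZMod (2 ^ 3))) : Matrix (Fin 2) (Fin 2) (ZMod (2 ^ 3))) = !![1, 1; 0, 1])
    (hτ : t ^ 2 ^ 3 = 1) : ∀ z : E, π z = 1 → z ∈ commutator E → z = 1 := by
  haveI : Fact (Nat.Prime 2) := ⟨Nat.prime_two⟩
  obtain ⟨l, hl'⟩ := hsurj ⟨!![1, 0; 1, 1], by simp [Matrix.det_fin_two_of]⟩
  have hl : ((π l : SL(2, ZMod (2 ^ 3))) : Matrix (Fin 2) (Fin 2) (ZMod (2 ^ 3))) = !![1, 0; 1, 1] := by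
    rw [hl']
  set u : E := l ^ 2 with hu
  set e₀ : E := t ^ 2 ^ (3 - 1) with he₀
  set f₀ : E := l ^ 2 ^ (3 - 1) with hf₀
  set h₁ : E := t * f₀ * t⁻¹ * f₀⁻¹ * e₀ with hh₁
  set d : E := ⁅t, u⁆ with hd
  set y : E := ⁅u, d⁆ with hy
  set b : E := ⁅t ^ 2, u⁆ with hb
  -- relations
  have hdy : Commute d y := commute_d_y hcen ht hl hu hd hy
  have hd4 : d ^ 4 = 1 := d_pow_four hcen hK2 he₀ hf₀ hh₁ ht hl hτ hu hd hy
  have hy2 : y * y = 1 := y_sq hcen hK2 he₀ hf₀ hh₁ ht hl hτ hu hd hy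
  have htd : t * d * t⁻¹ = y * d ^ 3 := t_conj_d' hcen hK2 he₀ hf₀ hh₁ ht hl hτ hu hd hy hb
  have htid : t⁻¹ * d * t = y * d ^ 3 := tinv_conj_d hcen hK2 he₀ hf₀ hh₁ ht hl hτ hu hd hy hb
  have hud : u * d * u⁻¹ = y * d := u_conj_d hy
  have huid : u⁻¹ * d * u = y * d := uinv_conj_d hcen hK2 he₀ hf₀ hh₁ ht hl hτ hu hd hy
  have hty : t * y * t⁻¹ = y := t_conj_y hcen hK2 he₀ hf₀ hh₁ ht hl hτ hu hd hy hb
  have huy : u * y * u⁻¹ = y := u_conj_y hcen hK2 ht hl hu hd hy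
  have htiy : t⁻¹ * y * t = y := by
    calc t⁻¹ * y * t = t⁻¹ * (t * y * t⁻¹) * t := by rw [hty]
      _ = y := by group
  have huiy : u⁻¹ * y * u = y := by
    calc u⁻¹ * y * u = u⁻¹ * (u * y * u⁻¹) * u := by rw [huy]
      _ = y := by group
  -- the subgroup `D̂ = {dⁱ yʲ}`
  let D : Subgroup E :=
    { carrier := {g | ∃ i j : ℕ, g = d ^ i * y ^ j}
      one_mem' := ⟨0, 0, by rw [pow_zero, pow_zero, mul_one]⟩
      mul_mem' := by
        rintro _ _ ⟨i, j, rfl⟩ ⟨i', j', rfl⟩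
        refine ⟨i + i', j + j', ?_⟩
        rw [pow_add, pow_add, mul_assoc, ← mul_assoc (y ^ j), (hdy.pow_pow i' j).symm.eq]; group
      inv_mem' := by
        rintro _ ⟨i, j, rfl⟩
        refine ⟨3 * i, j, ?_⟩
        apply inv_eq_of_mul_eq_one_right
        calc d ^ i * y ^ j * (d ^ (3 * i) * y ^ j) = d ^ i * (y ^ j * d ^ (3 * i)) * y ^ j := by group
          _ = d ^ i * (d ^ (3 * i) * y ^ j) * y ^ j := by rw [(hdy.pow_pow (3 * i) j).symm.eq]
          _ = (d ^ 4) ^ i * (y * y) ^ j := by rw [← pow_two, ← pow_mul, ← pow_mul]; group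
          _ = 1 := by rw [hd4, hy2, one_pow, one_pow, one_mul] }
  have hDmem : ∀ g, g ∈ D ↔ ∃ i j : ℕ, g = d ^ i * y ^ j := fun g ↦ Iff.rfl
  -- `D̂ ∩ ker π = 1`
  have hDker : ∀ g ∈ D, π g = 1 → g = 1 := by
    intro g hg hπg
    obtain ⟨i, j, rfl⟩ := (hDmem g).mp hg
    have hi : d ^ i = d ^ (i % 4) := by
      conv_lhs => rw [← Nat.div_add_mod i 4, pow_add, pow_mul, hd4, one_pow, one_mul]
    have hj : y ^ j = y ^ (j % 2) := by
      conv_lhs => rw [← Nat.div_add_mod j 2, pow_add, pow_mul, pow_two, hy2, one_pow, one_mul]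
    rw [hi, hj] at hπg ⊢
    have hπ : π d ^ (i % 4) * π y ^ (j % 2) = 1 := by rw [← map_pow, ← map_pow, ← map_mul, hπg]
    have hπd : π d = ⁅π t, π l ^ 2⁆ := by rw [hd, hu, map_commutatorElement, map_pow]
    have hπy : π y = ⁅π l ^ 2, ⁅π t, π l ^ 2⁆⁆ := by
      rw [hy, hd, hu, map_commutatorElement, map_commutatorElement, map_pow]
    rw [hπd, hπy] at hπ
    obtain ⟨h0, h0'⟩ := D_pow_mul_Y_pow_eq_one (π t) (π l) ht hl (Nat.mod_lt i (by norm_num))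
      (Nat.mod_lt j (by norm_num)) hπ
    rw [h0, h0', pow_zero, pow_zero, mul_one]
  -- `D̂` is normalised by `t^{±1}`, `u^{±1}` and the kernel
  have hconjD : ∀ (g : E), (g * d * g⁻¹ = y * d ^ 3 ∨ g * d * g⁻¹ = y * d ∨ g * d * g⁻¹ = d) → g * y * g⁻¹ = y →
      ∀ x ∈ D, g * x * g⁻¹ ∈ D := by
    intro g hgd hgy x hx
    obtain ⟨i, j, rfl⟩ := (hDmem x).mp hx
    have h1 : g * (d ^ i * y ^ j) * g⁻¹ = (g * d * g⁻¹) ^ i * (g * y * g⁻¹) ^ j := by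
      rw [conj_pow, conj_pow]; group
    rw [h1, hgy]
    rcases hgd with h | h | h <;> rw [h]
    · refine (hDmem _).mpr ⟨3 * i, i + j, ?_⟩
      rw [(hdy.symm.pow_right 3).mul_pow, ← pow_mul, pow_add, mul_comm 3 i]
      rw [mul_assoc, ← mul_assoc (d ^ (i * 3)), ((hdy.pow_pow (i * 3) i)).eq]; group
    · refine (hDmem _).mpr ⟨i, i + j, ?_⟩
      rw [hdy.symm.mul_pow, pow_add, mul_assoc, ← mul_assoc (d ^ i), (hdy.pow_pow i i).eq]; group
    · exact (hDmem _).mpr ⟨i, j, rfl⟩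
  have hDt : ∀ x ∈ D, t * x * t⁻¹ ∈ D := hconjD t (Or.inl htd) hty
  have hDti : ∀ x ∈ D, t⁻¹ * x * t ∈ D := by
    have h := hconjD t⁻¹ (Or.inl (by rw [inv_inv]; exact htid)) (by rw [inv_inv]; exact htiy)
    simpa only [inv_inv] using h
  have hDu : ∀ x ∈ D, u * x * u⁻¹ ∈ D := hconjD u (Or.inr (Or.inl hud)) huy
  have hDui : ∀ x ∈ D, u⁻¹ * x * u ∈ D := by
    have h := hconjD u⁻¹ (Or.inr (Or.inl (by rw [inv_inv]; exact huid))) (by rw [inv_inv]; exact huiy)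
    simpa only [inv_inv] using h
  have hDk : ∀ k : E, π k = 1 → ∀ x ∈ D, k * x * k⁻¹ ∈ D := by
    intro k hk x hx
    rw [← hcen k hk x, mul_inv_cancel_right]; exact hx
  -- the subgroup `H₀` generated by `t`, `u` and the kernel
  set S : Set E := {t, u} ∪ {k | π k = 1} with hS
  set H₀ : Subgroup E := Subgroup.closure S with hH₀
  have htH₀ : t ∈ H₀ := Subgroup.subset_closure (by simp [hS])
  have huH₀ : u ∈ H₀ := Subgroup.subset_closure (by simp [hS])
  have hkH₀ : ∀ k, π k = 1 → k ∈ H₀ := fun k hk ↦ Subgroup.subset_closure (by simp [hS, hk])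
  have hdH₀ : d ∈ H₀ := by
    rw [hd, commutatorElement_def]; exact mul_mem (mul_mem (mul_mem htH₀ huH₀) (inv_mem htH₀)) (inv_mem huH₀)
  have hyH₀ : y ∈ H₀ := by
    rw [hy, commutatorElement_def]; exact mul_mem (mul_mem (mul_mem huH₀ hdH₀) (inv_mem huH₀)) (inv_mem hdH₀)
  have hDH₀ : D ≤ H₀ := by
    intro x hx; obtain ⟨i, j, rfl⟩ := (hDmem x).mp hx; exact mul_mem (pow_mem hdH₀ _) (pow_mem hyH₀ _)
  -- every element of `H₀` normalises `D̂`
  have hnormD : ∀ h ∈ H₀, ∀ x ∈ D, h * x * h⁻¹ ∈ D ∧ h⁻¹ * x * h ∈ D := by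
    intro h hh
    refine Subgroup.closure_induction (p := fun h _ ↦ ∀ x ∈ D, h * x * h⁻¹ ∈ D ∧ h⁻¹ * x * h ∈ D) ?_ ?_ ?_ ?_ hh
    · intro s hs x hx
      simp only [hS, Set.mem_union, Set.mem_insert_iff, Set.mem_singleton_iff, Set.mem_setOf_eq] at hs
      rcases hs with (rfl | rfl) | hs
      · exact ⟨hDt x hx, hDti x hx⟩
      · exact ⟨hDu x hx, hDui x hx⟩
      · refine ⟨hDk s hs x hx, ?_⟩
        have := hDk s⁻¹ (by rw [map_inv, hs, inv_one]) x hx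
        simpa using this
    · intro x hx; simp [hx]
    · intro a c _ _ ha hc x hx
      obtain ⟨hc1, hc2⟩ := hc x hx
      obtain ⟨ha1, _⟩ := ha _ hc1
      obtain ⟨_, ha2'⟩ := ha x hx
      obtain ⟨_, hc2'⟩ := hc _ ha2'
      exact ⟨by simpa [mul_assoc] using ha1, by simpa [mul_assoc] using hc2'⟩
    · intro a _ ha x hx
      obtain ⟨ha1, ha2⟩ := ha x hx
      exact ⟨by simpa using ha2, by simpa using ha1⟩
  -- commutators of elements of `H₀` lie in `D̂`
  have hgen_comm : ∀ s ∈ S, ∀ s' ∈ S, ⁅s, s'⁆ ∈ D := by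
    intro s hs s' hs'
    simp only [hS, Set.mem_union, Set.mem_insert_iff, Set.mem_singleton_iff, Set.mem_setOf_eq] at hs hs'
    have hk1 : ∀ k g : E, π k = 1 → ⁅k, g⁆ = 1 := fun k g hk ↦ by
      rw [commutatorElement_eq_one_iff_mul_comm]; exact (hcen k hk g).symm
    have hk2 : ∀ k g : E, π k = 1 → ⁅g, k⁆ = 1 := fun k g hk ↦ by
      rw [commutatorElement_eq_one_iff_mul_comm]; exact hcen k hk g
    rcases hs with (rfl | rfl) | hs
    · rcases hs' with (rfl | rfl) | hs'
      · rw [commutatorElement_self]; exact D.one_mem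
      · exact (hDmem _).mpr ⟨1, 0, by rw [hd, pow_one, pow_zero, mul_one]⟩
      · rw [hk2 s' _ hs']; exact D.one_mem
    · rcases hs' with (rfl | rfl) | hs'
      · rw [← commutatorElement_inv, ← hd]; exact D.inv_mem ((hDmem _).mpr ⟨1, 0, by rw [pow_one, pow_zero, mul_one]⟩)
      · rw [commutatorElement_self]; exact D.one_mem
      · rw [hk2 s' _ hs']; exact D.one_mem
    · rw [hk1 s s' hs]; exact D.one_mem
  have hcommD : ∀ a ∈ H₀, ∀ c ∈ H₀, ⁅a, c⁆ ∈ D := by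
    intro a ha
    refine Subgroup.closure_induction (p := fun a _ ↦ ∀ c ∈ H₀, ⁅a, c⁆ ∈ D) ?_ ?_ ?_ ?_ ha
    · intro s hs c hc
      refine Subgroup.closure_induction (p := fun c _ ↦ ⁅s, c⁆ ∈ D) ?_ ?_ ?_ ?_ hc
      · intro s' hs'; exact hgen_comm s hs s' hs'
      · rw [commutatorElement_one_right]; exact D.one_mem
      · intro c c' hc' _ h1 h2
        rw [comm_mul_right]
        exact D.mul_mem h1 (hnormD c hc' _ h2).1
      · intro c hc' h1
        have : ⁅s, c⁻¹⁆ = c⁻¹ * ⁅s, c⁆⁻¹ * c := by simp only [commutatorElement_def]; group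
        rw [this]
        have := (hnormD c hc' _ (D.inv_mem h1)).2
        simpa [mul_assoc] using this
    · intro c _; rw [commutatorElement_one_left]; exact D.one_mem
    · intro a a' ha' _ h1 h2 c hc
      rw [comm_mul_left]
      exact D.mul_mem (hnormD a ha' _ (h2 c hc)).1 (h1 c hc)
    · intro a ha' h1 c hc
      have : ⁅a⁻¹, c⁆ = a⁻¹ * ⁅a, c⁆⁻¹ * a := by simp only [commutatorElement_def]; group
      rw [this]
      have := (hnormD a ha' _ (D.inv_mem (h1 c hc))).2
      simpa [mul_assoc] using this
  -- the reductions
  set r₂ := Matrix.SpecialLinearGroup.map (n := Fin 2) (ZMod.castHom (show 2 ∣ 2 ^ 3 by norm_num) (ZMod 2))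
    with hr₂
  set r₄ := Matrix.SpecialLinearGroup.map (n := Fin 2)
    (ZMod.castHom (pow_dvd_pow 2 (Nat.sub_le 3 1)) (ZMod (2 ^ (3 - 1)))) with hr₄
  set red₂ := Matrix.SpecialLinearGroup.map (n := Fin 2) (Int.castRingHom (ZMod 2)) with hred₂
  haveI : NeZero (2 : ℕ) := ⟨two_ne_zero⟩
  have hr₂surj : Function.Surjective r₂ := SL2TopLayer.map_castHom_surjective (2 ^ 3) _
  let π₂ : E →* SL(2, ZMod 2) := r₂.comp π
  have hπ₂surj : Function.Surjective π₂ := hr₂surj.comp hsurj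
  -- the index-3 subgroup `H` = preimage of the Sylow subgroup `⟨T̄, U⟩` (image of `Γ₁(2)` mod 2)
  set U₂ : Subgroup SL(2, ZMod 2) := (CongruenceSubgroup.Gamma1 2).map red₂ with hU₂
  set H : Subgroup E := U₂.comap π₂ with hH
  have hredsurj : Function.Surjective red₂ :=
    Literature.NumberTheory.EllipticCurves.ModularForms.specialLinearGroup_map_surjective 2
  have hidx : H.index = 3 := by
    rw [hH, Subgroup.index_comap_of_surjective _ hπ₂surj, hU₂, Subgroup.index_map_eq _ hredsurj]
    · have h := Literature.NumberTheory.EllipticCurves.ModularForms.card_unimodular_prime_pow Nat.prime_two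
        Nat.one_pos
      rw [pow_one] at h
      rw [Literature.NumberTheory.EllipticCurves.ModularForms.index_gamma1_eq_card, h]
      norm_num
    · intro g hg
      rw [MonoidHom.mem_ker] at hg
      exact Literature.NumberTheory.EllipticCurves.ModularForms.Gamma_le_Gamma1 2
        (CongruenceSubgroup.Gamma_mem'.mpr hg)
  haveI : H.FiniteIndex := ⟨by rw [hidx]; norm_num⟩
  -- `H ≤ H₀`: decomposition through the layers
  have hπ₂t : π₂ t = red₂ ModularGroup.T := by
    apply Subtype.ext
    rw [SL2TopLayer.coe_map_T]
    show ((r₂ (π t) : SL(2, ZMod 2)) : Matrix (Fin 2) (Fin 2) (ZMod 2)) = !![1, 1; 0, 1]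
    rw [hr₂, Matrix.SpecialLinearGroup.map_apply_coe, RingHom.mapMatrix_apply, ht]
    ext i j; fin_cases i <;> fin_cases j <;> simp [Matrix.map_apply, -ZMod.castHom_apply]
  have hstage1 : ∀ x ∈ H, ∃ (k : ℕ) (x₁ : E), r₂ (π x₁) = 1 ∧ x = t ^ k * x₁ := by
    intro x hx
    rw [hH, Subgroup.mem_comap, hU₂, Subgroup.mem_map] at hx
    obtain ⟨γ, hγ, hγx⟩ := hx
    obtain ⟨h00, h11, h10⟩ := (CongruenceSubgroup.Gamma1_mem 2 γ).mp hγ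
    set k : ℕ := ((γ 0 1 : ℤ) : ZMod 2).val with hk
    have hπx : π₂ x = π₂ (t ^ k) := by
      rw [map_pow, hπ₂t, ← hγx]
      ext i j
      rw [SL2TopLayer.tBar_pow _ (SL2TopLayer.coe_map_T 2) k, hk, ZMod.natCast_zmod_val]
      fin_cases i <;> fin_cases j <;> simp [hred₂, h00, h11, h10]
    refine ⟨k, (t ^ k)⁻¹ * x, ?_, by group⟩
    have : π₂ ((t ^ k)⁻¹ * x) = 1 := by rw [map_mul, map_inv, hπx, inv_mul_cancel]
    exact this
  have hstage2 : ∀ x₁ : E, r₂ (π x₁) = 1 → ∃ w ∈ H₀, r₄ (π (x₁ * w⁻¹)) = 1 := by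
    intro x₁ hx₁
    have hM : Matrix.SpecialLinearGroup.map (ZMod.castHom (pow_dvd_pow 2 (Nat.sub_le 2 1)) (ZMod (2 ^ (2 - 1))))
        (r₄ (π x₁)) = 1 := by
      rw [hr₄, map_castHom_four_two]; exact hx₁
    obtain ⟨a, b', c, habc⟩ := SL2TopLayer.exists_eq_pow_mul_pow_mul_pow 2 2 le_rfl (r₄ (π (t ^ 2)))
      (r₄ (π u)) (r₄ (π (t ^ 2 * d))) (by rw [map_pow, hr₄]; exact coe_red4_T_sq (π t) ht)
      (by rw [hu, map_pow, hr₄]; exact coe_red4_L_sq (π l) hl)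
      (by rw [map_mul, map_pow, hd, hu, map_commutatorElement, map_pow, hr₄]; exact coe_red4_T_sq_D (π t) (π l) ht hl)
      hM
    refine ⟨(t ^ 2) ^ b' * (t ^ 2 * d) ^ a * u ^ c, ?_, ?_⟩
    · exact mul_mem (mul_mem (pow_mem (pow_mem htH₀ 2) _) (pow_mem (mul_mem (pow_mem htH₀ 2) hdH₀) _))
        (pow_mem huH₀ _)
    · rw [map_mul, map_inv, map_mul, map_inv, habc]
      simp only [map_mul, map_pow]
      rw [mul_inv_cancel]
  have hstage3 : ∀ x₂ : E, r₄ (π x₂) = 1 → x₂ ∈ H₀ := by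
    intro x₂ hx₂
    obtain ⟨a, b', c, z, hz, rfl⟩ := SL2CentralExtension.exists_decomp he₀ hf₀ hh₁ ht hl (by norm_num : 2 ≤ 3) hx₂
    have he₀H : e₀ ∈ H₀ := by rw [he₀]; exact pow_mem htH₀ _
    have hf₀H : f₀ ∈ H₀ := by
      rw [hf₀, show l ^ 2 ^ (3 - 1) = (l ^ 2) ^ 2 by rw [← pow_mul]; norm_num, ← hu]; exact pow_mem huH₀ 2
    have hh₁H : h₁ ∈ H₀ := by
      rw [hh₁]
      exact mul_mem (mul_mem (mul_mem (mul_mem htH₀ hf₀H) (inv_mem htH₀)) (inv_mem hf₀H)) he₀H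
    exact mul_mem (mul_mem (mul_mem (pow_mem he₀H _) (pow_mem hh₁H _)) (pow_mem hf₀H _)) (hkH₀ z hz)
  have hHH₀ : H ≤ H₀ := by
    intro x hx
    obtain ⟨k, x₁, hx₁, rfl⟩ := hstage1 x hx
    obtain ⟨w, hw, hx₂⟩ := hstage2 x₁ hx₁
    have : x₁ = (x₁ * w⁻¹) * w := by group
    rw [this]
    exact mul_mem (pow_mem htH₀ k) (mul_mem (hstage3 _ hx₂) hw)
  -- `[H₀, H₀] ⊆ D̂`
  have hcommH₀ : commutator H₀ ≤ D.subgroupOf H₀ := by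
    rw [commutator_def, Subgroup.commutator_le]
    rintro ⟨a, ha⟩ - ⟨c, hc⟩ -
    rw [Subgroup.mem_subgroupOf]
    have : ((⁅(⟨a, ha⟩ : H₀), (⟨c, hc⟩ : H₀)⁆ : H₀) : E) = ⁅a, c⁆ := by
      simp only [commutatorElement_def, Subgroup.coe_mul, Subgroup.coe_inv]
    rw [this]
    exact hcommD a ha c hc
  -- transfer
  intro z hz hzc
  have hzH : z ∈ H := by
    rw [hH, Subgroup.mem_comap]
    have : π₂ z = 1 := by
      show r₂ (π z) = 1
      rw [hz, map_one]
    rw [this]; exact U₂.one_mem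
  have hzcen : z ∈ Subgroup.center E := by
    rw [Subgroup.mem_center_iff]; exact fun g ↦ hcen z hz g
  have h1 := Literature.NumberTheory.Automorphic.UnboundedDenominators.pow_index_mem_commutator_of_mem_center
    H hzH hzcen hzc
  rw [hidx] at h1
  -- push into `H₀`
  have h2 : (⟨z, hHH₀ hzH⟩ : H₀) ^ 3 ∈ commutator H₀ := by
    have h3 := Subgroup.mem_map_of_mem (Subgroup.inclusion hHH₀) h1
    rw [map_pow] at h3
    have h4 : (commutator H).map (Subgroup.inclusion hHH₀) ≤ commutator H₀ := by
      rw [commutator_def, commutator_def, Subgroup.map_commutator]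
      exact Subgroup.commutator_mono le_top le_top
    exact h4 h3
  have h3 : z ^ 3 ∈ D := by
    have h4 := hcommH₀ h2
    rw [Subgroup.mem_subgroupOf, Subgroup.coe_pow] at h4
    exact h4
  have h4 : z ^ 3 = 1 := hDker _ h3 (by rw [map_pow, hz, one_pow])
  have h5 : z ^ 2 = 1 := hK2 z hz
  calc z = z ^ 3 * (z ^ 2)⁻¹ := by group
    _ = 1 := by rw [h4, h5, inv_one, mul_one]

end SL2Mod8

end Literature.GroupTheory.ArithmeticGroups
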